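import Summits.CriticalPhenomena.Ising3DConformalLimit.Theses.FKParityRobustness
import Literature.Probability.LatticeModels.WeightedCurrents
import Literature.Probability.LatticeModels.IsingTransport
import Literature.Probability.LatticeModels.CriticalCorrWellDefined
import Summits.CriticalPhenomena.Ising3DConformalLimit.Theorems.FKParityRobustnessParityBoundCurrents

/-!
# `JoinForcesU4` (route `FKParityRobustness`, item `stmt-CriticalPhenomena-14627`) — candidate proof file

CANDIDATE THEOREMS FILE prepared by the crux-ideation planner (k = 2, round 1); kernel-checked on the farm
(rc 0, 0 sorries; audit: proof-of-item for `JoinForcesU4`, `StrandsJoinBound` (14647),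
`LatticeBoundFromStrands` (14648), `FarMergingGivesU4` (4471); axioms propext / Classical.choice / Quot.sound).
The planner role cannot propose to `Theorems/`; a prover may land this file as is.

Chain: (A) `strandsJoinBoundShape_holds` — Aizenman's `U₄` identity in the additive `ℝ≥0∞` product form
(`Current.ursellFour_currentSum_identity`) + the two-copy odd-part pushforward (`twoCopyPushforward_holds`,
from the landed one-copy lemma `tsum_sources_eweight_mul_apply_oddPart` applied twice) + `odd ⊆ trace`;
(B) `latticeBoundShape_holds` — K1 at `N ≥ max N₀ l`, (A) on the induced box graph, free-measure transport
(`isingExpect_free_map`) and the seven free box limits (`criticalCorr_wellDefined_holds`) through the closed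
cone `tetraDefect_le_of_tendsto'`; (C) `farMergingShape_holds` — mesh `δ_L = L⁻¹` (`latticeApprox` exact on
integer points), the same closed cone on the NeBot filter of good scales, bihomogeneity, strictness from ND.

References: M. Aizenman, Comm. Math. Phys. 86 (1982) [AizenmanCMP1982]; M. Aizenman, H. Duminil-Copin,
Ann. of Math. 194 (2021), eq. (3.11) [AizenmanDuminilCopinAnnals2021]; H. Duminil-Copin, arXiv:1607.06933,
Remark 3.4, eq. (24) [DuminilCopin2016]; U. T. Hansen, J. Jiang, F. R. Klausen, arXiv:2506.10765, §2
[HansenJiangKlausen2025]; S. Friedli, Y. Velenik, CUP 2017, §3.1 (free-measure transport) [FriedliVelenik2017].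
Disproof.lean (cdisprove cycle 1, `Cruxes/JoinForcesU4/Disproof.lean`) honoured: `crux_of_supports`
(`StrandsJoinBound → LatticeBoundFromStrands → JoinForcesU4`) is realised here by PROVING both supports;
`iff_withoutPositivity` — `hρ` is never used; `withoutNondegeneracy_iff_not_strandsJoin` /
`withoutLimit_iff_not_strandsJoin` — non-degeneracy (strictness in step (C)) and the lattice limit (`alongMesh`)
are used, not bypassed; `farMergingGivesU4_holds` there is an independent proof of item 4471 (ours:
`farMergingShape_holds`).
-/


namespace Summit.CriticalPhenomena.Ising3DConformalLimit.Theorems.JoinForcesU4Proof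

open scoped BigOperators symmDiff ENNReal Topology
open Finset Filter Literature.Probability.LatticeModels
open Summit.CriticalPhenomena.Ising3DConformalLimit.Theses.FKParityRobustness

noncomputable section

/-! ### Card 1 — `ennreal-two-copy-parity-bound` -/

section Card1

open scoped Classical

/-- The joint loop-O(1) sum of the crux hypothesis: verbatim the double sum of
`IndependentStrandsJoin` / `StrandsJoinBound`, on a general finite graph. -/
def jointSum {V : Type*} [Fintype V] [DecidableEq V] (G : SimpleGraph V) [DecidableRel G.Adj]
    (t : ℝ) (a : Fin 4 → V) : ℝ :=
  ∑ F₁ ∈ tJoins G Set.univ {a 0, a 1}, ∑ F₂ ∈ tJoins G Set.univ {a 2, a 3},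
    if (SimpleGraph.fromEdgeSet ((↑F₁ : Set (Sym2 V)) ∪ ↑F₂)).Reachable (a 0) (a 2)
      then t ^ (#F₁ + #F₂) else 0

/-- FIRST LEMMA 1a — **two-copy odd-part pushforward identity** (`ℝ≥0∞`): pushing the pair
`(n₁, n₂) ~ 1{∂n₁ = a₀a₁}1{∂n₂ = a₂a₃} w_β w_β` forward along `(odd n₁, odd n₂)` turns the indicator
of `a₀ ↔ a₂ in odd(n₁) ∪ odd(n₂)` into `cosh(β)^{2|E|} · jointSum_{tanh β}`. Proof plan:
`epairWeight_eq_mul` + `ENNReal.tsum_prod'` + `ENNReal.tsum_mul_left` + TWICE the landed one-copy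
lemma `tsum_sources_eweight_mul_apply_oddPart` (Theorems/FKParityRobustnessParityBoundCurrents). -/
def TwoCopyPushforward : Prop :=
  ∀ (V : Type) [Fintype V] [DecidableEq V] (G : SimpleGraph V) [DecidableRel G.Adj] (β : ℝ), 0 ≤ β →
    ∀ a : Fin 4 → V, Function.Injective a →
      ∑' p : Current G × Current G,
          epairWeight (fun _ : G.edgeFinset => β) ({a 0} ∆ {a 1}) ({a 2} ∆ {a 3}) p *
            (if (SimpleGraph.fromEdgeSet
                ((↑((univ.filter fun e : G.edgeFinset => Odd (p.1 e)).map
                    (Function.Embedding.subtype _)) : Set (Sym2 V)) ∪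
                  ↑((univ.filter fun e : G.edgeFinset => Odd (p.2 e)).map
                    (Function.Embedding.subtype _)))).Reachable (a 0) (a 2)
              then 1 else 0) =
        ENNReal.ofReal (Real.cosh β ^ (2 * #G.edgeFinset) * jointSum G (Real.tanh β) a)

/-- FIRST LEMMA 1b — **two-copy parity bound**, the two-copy analogue of the landed
`currentSum_four_add_oddPart_le`, in the additive `ℝ≥0∞` product form of
`Current.ursellFour_currentSum_identity`:
`Z[D]·Z[∅] + 2·cosh(β)^{2|E|}·jointSum ≤ Z[a₀a₁]Z[a₂a₃] + Z[a₀a₂]Z[a₁a₃] + Z[a₀a₃]Z[a₁a₂]`.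
From 1a and `odd(nᵢ) ⊆ trace(n₁+n₂)` (`coe_oddPart_subset_traced_add`, both copies). -/
def TwoCopyOddPartBound : Prop :=
  ∀ (V : Type) [Fintype V] [DecidableEq V] (G : SimpleGraph V) [DecidableRel G.Adj] (β : ℝ), 0 ≤ β →
    ∀ a : Fin 4 → V, Function.Injective a →
      ecurrentSum (fun _ : G.edgeFinset => β) ({a 0} ∆ ({a 1} ∆ ({a 2} ∆ {a 3}))) *
          ecurrentSum (fun _ : G.edgeFinset => β) ∅ +
        2 * ENNReal.ofReal (Real.cosh β ^ (2 * #G.edgeFinset) * jointSum G (Real.tanh β) a) ≤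
      ecurrentSum (fun _ : G.edgeFinset => β) ({a 0} ∆ {a 1}) *
          ecurrentSum (fun _ : G.edgeFinset => β) ({a 2} ∆ {a 3}) +
        ecurrentSum (fun _ : G.edgeFinset => β) ({a 0} ∆ {a 2}) *
          ecurrentSum (fun _ : G.edgeFinset => β) ({a 1} ∆ {a 3}) +
        ecurrentSum (fun _ : G.edgeFinset => β) ({a 0} ∆ {a 3}) *
          ecurrentSum (fun _ : G.edgeFinset => β) ({a 1} ∆ {a 2})

/-- `odd(n₁) ∪ odd(n₂) ⊆ trace(n₁ + n₂)`, so joining in the odd parts implies joining in the double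
current (PROVED from the landed `coe_oddPart_subset_traced_add`). -/
theorem ite_reachable_oddPart_le {V : Type*} [Fintype V] [DecidableEq V] {G : SimpleGraph V}
    [DecidableRel G.Adj] (a : Fin 4 → V) (p : Current G × Current G) :
    (if (SimpleGraph.fromEdgeSet
          ((↑((univ.filter fun e : G.edgeFinset => Odd (p.1 e)).map
              (Function.Embedding.subtype _)) : Set (Sym2 V)) ∪
            ↑((univ.filter fun e : G.edgeFinset => Odd (p.2 e)).map
              (Function.Embedding.subtype _)))).Reachable (a 0) (a 2)
        then (1 : ℝ≥0∞) else 0) ≤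
      (if a 2 ∈ (p.1 + p.2).cluster (a 0) then 1 else 0) := by
  by_cases h : (SimpleGraph.fromEdgeSet
          ((↑((univ.filter fun e : G.edgeFinset => Odd (p.1 e)).map
              (Function.Embedding.subtype _)) : Set (Sym2 V)) ∪
            ↑((univ.filter fun e : G.edgeFinset => Odd (p.2 e)).map
              (Function.Embedding.subtype _)))).Reachable (a 0) (a 2)
  · have h2 : (↑((univ.filter fun e : G.edgeFinset => Odd (p.2 e)).map
        (Function.Embedding.subtype _)) : Set (Sym2 V)) ⊆ (p.1 + p.2).traced := by
      rw [add_comm]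
      exact Summit.CriticalPhenomena.Ising3DConformalLimit.Theorems.coe_oddPart_subset_traced_add p.2 p.1
    have hle : SimpleGraph.fromEdgeSet
          ((↑((univ.filter fun e : G.edgeFinset => Odd (p.1 e)).map
              (Function.Embedding.subtype _)) : Set (Sym2 V)) ∪
            ↑((univ.filter fun e : G.edgeFinset => Odd (p.2 e)).map
              (Function.Embedding.subtype _))) ≤
        Literature.Probability.Percolation.openGraph (p.1 + p.2).traced :=
      SimpleGraph.fromEdgeSet_mono (Set.union_subset
        (Summit.CriticalPhenomena.Ising3DConformalLimit.Theorems.coe_oddPart_subset_traced_add p.1 p.2) h2)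
    rw [if_pos h, if_pos (Current.mem_cluster_iff.2 (h.mono hle))]
  · rw [if_neg h]
    exact bot_le

/-- `tJoins G univ A` is the powerset filtered by the source condition alone. -/
theorem tJoins_univ_eq_filter {V : Type*} [Fintype V] [DecidableEq V] (G : SimpleGraph V)
    [DecidableRel G.Adj] (A : Finset V) :
    tJoins G Set.univ A =
      G.edgeFinset.powerset.filter (fun F => ∀ v, Odd #(F.filter (v ∈ ·)) ↔ v ∈ A) := by
  unfold tJoins
  exact Finset.filter_congr fun F _ => by simp only [Set.subset_univ, true_and]

/-- **1a PROVED** — the two-copy odd-part pushforward identity: `ENNReal.tsum_prod'` +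
`ENNReal.tsum_mul_left` + the landed one-copy lemma `tsum_sources_eweight_mul_apply_oddPart` TWICE
(inner copy with test function `F₂ ↦ 1[a₀ ↔ a₂ in odd(n₁) ∪ F₂]`, outer copy with the resulting finite
sum), then `sinh^k cosh^{|E|-k} = cosh^{|E|} tanh^k` termwise. -/
theorem twoCopyPushforward_holds : TwoCopyPushforward := by
  intro V _ _ G _ β hβ a ha
  -- notation
  set gI : Finset (Sym2 V) → Finset (Sym2 V) → ℝ≥0∞ := fun F₁ F₂ =>
    if (SimpleGraph.fromEdgeSet ((↑F₁ : Set (Sym2 V)) ∪ ↑F₂)).Reachable (a 0) (a 2) then 1 else 0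
    with hgI
  set oddP : Current G → Finset (Sym2 V) := fun n =>
    (univ.filter fun e : G.edgeFinset => Odd (n e)).map (Function.Embedding.subtype _) with hoddP
  set sc : Finset (Sym2 V) → ℝ≥0∞ := fun F =>
    ENNReal.ofReal (Real.sinh β ^ #F * Real.cosh β ^ (#G.edgeFinset - #F)) with hsc
  have h01 : ({a 0} : Finset V) ∆ {a 1} = {a 0, a 1} :=
    Current.symmDiff_singleton_eq_pair (ha.ne (by decide))
  have h23 : ({a 2} : Finset V) ∆ {a 3} = {a 2, a 3} :=
    Current.symmDiff_singleton_eq_pair (ha.ne (by decide))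
  rw [h01, h23]
  -- the test function of the outer pushforward
  set H : Finset (Sym2 V) → ℝ≥0∞ := fun F₁ =>
    ∑ F₂ ∈ G.edgeFinset.powerset,
      if (∀ v, Odd #(F₂.filter (v ∈ ·)) ↔ v ∈ ({a 2, a 3} : Finset V)) then sc F₂ * gI F₁ F₂ else 0
    with hH
  -- Step 1: iterate the tsum and factor the first weight out of the inner sum
  have step1 : (∑' p : Current G × Current G,
        epairWeight (fun _ : G.edgeFinset => β) {a 0, a 1} {a 2, a 3} p * gI (oddP p.1) (oddP p.2)) =
      ∑' n₁ : Current G, (if n₁.sources = {a 0, a 1} then n₁.eweight (fun _ : G.edgeFinset => β) else 0) *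
        ∑' n₂ : Current G, (if n₂.sources = {a 2, a 3} then n₂.eweight (fun _ : G.edgeFinset => β) else 0) *
          gI (oddP n₁) (oddP n₂) := by
    rw [ENNReal.tsum_prod']
    refine tsum_congr fun n₁ => ?_
    rw [← ENNReal.tsum_mul_left]
    refine tsum_congr fun n₂ => ?_
    rw [epairWeight_eq_mul, mul_assoc]
  -- Step 2: inner pushforward (one copy), for each fixed `n₁`
  have step2 : ∀ n₁ : Current G,
      (∑' n₂ : Current G, (if n₂.sources = {a 2, a 3} then n₂.eweight (fun _ : G.edgeFinset => β) else 0) *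
          gI (oddP n₁) (oddP n₂)) = H (oddP n₁) := fun n₁ =>
    Summit.CriticalPhenomena.Ising3DConformalLimit.Theorems.tsum_sources_eweight_mul_apply_oddPart
      hβ {a 2, a 3} (gI (oddP n₁))
  -- Step 3: outer pushforward
  have step3 : (∑' n₁ : Current G, (if n₁.sources = {a 0, a 1} then n₁.eweight (fun _ : G.edgeFinset => β) else 0) *
        H (oddP n₁)) =
      ∑ F₁ ∈ G.edgeFinset.powerset,
        if (∀ v, Odd #(F₁.filter (v ∈ ·)) ↔ v ∈ ({a 0, a 1} : Finset V)) then sc F₁ * H F₁ else 0 :=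
    Summit.CriticalPhenomena.Ising3DConformalLimit.Theorems.tsum_sources_eweight_mul_apply_oddPart
      hβ {a 0, a 1} H
  -- assemble steps 1–3
  have lhs_eq : (∑' p : Current G × Current G,
        epairWeight (fun _ : G.edgeFinset => β) {a 0, a 1} {a 2, a 3} p * gI (oddP p.1) (oddP p.2)) =
      ∑ F₁ ∈ G.edgeFinset.powerset,
        if (∀ v, Odd #(F₁.filter (v ∈ ·)) ↔ v ∈ ({a 0, a 1} : Finset V)) then sc F₁ * H F₁ else 0 := by
    rw [step1, ← step3]
    exact tsum_congr fun n₁ => by rw [step2 n₁]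
  show (∑' p : Current G × Current G,
        epairWeight (fun _ : G.edgeFinset => β) {a 0, a 1} {a 2, a 3} p * gI (oddP p.1) (oddP p.2)) = _
  rw [lhs_eq]
  -- Step 4: identify the finite double sum with `cosh^{2|E|} · jointSum`
  rw [← Finset.sum_filter, ← tJoins_univ_eq_filter G {a 0, a 1}]
  have hH' : ∀ F₁, H F₁ = ∑ F₂ ∈ tJoins G Set.univ {a 2, a 3}, sc F₂ * gI F₁ F₂ := by
    intro F₁
    rw [hH, tJoins_univ_eq_filter G {a 2, a 3}, Finset.sum_filter]
  simp_rw [hH']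
  have ht : 0 ≤ Real.tanh β := by
    rw [Real.tanh_eq_sinh_div_cosh]
    exact div_nonneg (Real.sinh_nonneg_iff.2 hβ) (Real.cosh_pos β).le
  have hterm_nonneg : ∀ F₁ F₂ : Finset (Sym2 V), 0 ≤ Real.cosh β ^ (2 * #G.edgeFinset) *
      (if (SimpleGraph.fromEdgeSet ((↑F₁ : Set (Sym2 V)) ∪ ↑F₂)).Reachable (a 0) (a 2)
        then Real.tanh β ^ (#F₁ + #F₂) else 0) := by
    intro F₁ F₂
    refine mul_nonneg (pow_nonneg (Real.cosh_pos β).le _) ?_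
    split_ifs
    · exact pow_nonneg ht _
    · exact le_rfl
  have hR : ENNReal.ofReal (Real.cosh β ^ (2 * #G.edgeFinset) * jointSum G (Real.tanh β) a) =
      ∑ F₁ ∈ tJoins G Set.univ {a 0, a 1}, ∑ F₂ ∈ tJoins G Set.univ {a 2, a 3},
        ENNReal.ofReal (Real.cosh β ^ (2 * #G.edgeFinset) *
          (if (SimpleGraph.fromEdgeSet ((↑F₁ : Set (Sym2 V)) ∪ ↑F₂)).Reachable (a 0) (a 2)
            then Real.tanh β ^ (#F₁ + #F₂) else 0)) := by
    rw [jointSum, Finset.mul_sum]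
    rw [ENNReal.ofReal_sum_of_nonneg (fun F₁ _ => by
      rw [Finset.mul_sum]; exact Finset.sum_nonneg fun F₂ _ => hterm_nonneg F₁ F₂)]
    refine Finset.sum_congr rfl fun F₁ _ => ?_
    rw [Finset.mul_sum, ENNReal.ofReal_sum_of_nonneg (fun F₂ _ => hterm_nonneg F₁ F₂)]
  rw [hR]
  refine Finset.sum_congr rfl fun F₁ hF₁ => ?_
  rw [Finset.mul_sum]
  refine Finset.sum_congr rfl fun F₂ hF₂ => ?_
  have hk₁ : #F₁ ≤ #G.edgeFinset := Finset.card_le_card ((mem_tJoins G).1 hF₁).1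
  have hk₂ : #F₂ ≤ #G.edgeFinset := Finset.card_le_card ((mem_tJoins G).1 hF₂).1
  simp only [hsc, hgI]
  rw [Summit.CriticalPhenomena.Ising3DConformalLimit.Theorems.sinh_pow_mul_cosh_pow_sub β hk₁,
    Summit.CriticalPhenomena.Ising3DConformalLimit.Theorems.sinh_pow_mul_cosh_pow_sub β hk₂]
  have hc : 0 ≤ Real.cosh β ^ #G.edgeFinset := pow_nonneg (Real.cosh_pos β).le _
  by_cases hRch : (SimpleGraph.fromEdgeSet ((↑F₁ : Set (Sym2 V)) ∪ ↑F₂)).Reachable (a 0) (a 2)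
  · rw [if_pos hRch, if_pos hRch, mul_one,
      ← ENNReal.ofReal_mul (mul_nonneg hc (pow_nonneg ht _))]
    congr 1
    ring
  · rw [if_neg hRch, if_neg hRch, mul_zero, mul_zero, mul_zero, ENNReal.ofReal_zero]

/-- **1a ⇒ 1b** (PROVED): given the two-copy pushforward identity, the parity bound is the landed
`U₄` identity plus the pointwise comparison above — so the ONLY `M`-sized stub of step (A) is 1a. -/
theorem twoCopyOddPartBound_of_pushforward (hP : TwoCopyPushforward) : TwoCopyOddPartBound := by
  intro V _ _ G _ β hβ a ha
  have hK : ∀ _e : G.edgeFinset, 0 ≤ β := fun _ => hβ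
  rw [Current.ursellFour_currentSum_identity (K := fun _ => β) hK (a 0) (a 1) (a 2) (a 3),
    ← hP V G β hβ a ha]
  refine add_le_add le_rfl (mul_le_mul' le_rfl ?_)
  exact ENNReal.tsum_le_tsum fun p => mul_le_mul' le_rfl (ite_reachable_oddPart_le a p)

/-- The real-valued corollary of 1b is the filed support `StrandsJoinBound` (item 14647) verbatim:
divide by `Z[∅]² = cosh(β)^{2|E|}·(Z⁰_{tanh β})²` (`ecurrentSum_empty_eq_ofReal`, `toReal_ecurrentSum`,
`currentSum_eq_wcurrentSum`, `isingExpect_spinMonomial_four_eq`, `isingTwoPoint_free_eq_currentSum_div_holds`). -/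
def StrandsJoinBoundShape : Prop :=   -- = route decl `StrandsJoinBound` (item 14647), restated
    ∀ (V : Type) [Fintype V] [DecidableEq V] (G : SimpleGraph V) [DecidableRel G.Adj] (β : ℝ), 0 ≤ β →
      ∀ a : Fin 4 → V, Function.Injective a → (let t : ℝ := Real.tanh β;
        connectedFour (isingMeasure G Finset.univ β 0 .free) spinAt a *
            (loopO1PartitionFunction G t ∅) ^ 2 ≤
          -(2 * ∑ F₁ ∈ tJoins G Set.univ {a 0, a 1}, ∑ F₂ ∈ tJoins G Set.univ {a 2, a 3},
            if (SimpleGraph.fromEdgeSet ((↑F₁ : Set (Sym2 V)) ∪ ↑F₂)).Reachable (a 0) (a 2)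
              then t ^ (F₁.card + F₂.card) else 0))

/-- The inner sum of `StrandsJoinBoundShape` is `jointSum` (definitional). -/
example {V : Type} [Fintype V] [DecidableEq V] (G : SimpleGraph V) [DecidableRel G.Adj] (t : ℝ)
    (a : Fin 4 → V) :
    jointSum G t a = ∑ F₁ ∈ tJoins G Set.univ {a 0, a 1}, ∑ F₂ ∈ tJoins G Set.univ {a 2, a 3},
      if (SimpleGraph.fromEdgeSet ((↑F₁ : Set (Sym2 V)) ∪ ↑F₂)).Reachable (a 0) (a 2)
        then t ^ (F₁.card + F₂.card) else 0 := rfl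

/-- **1b PROVED unconditionally**: the two-copy parity bound in `ℝ≥0∞`. -/
theorem twoCopyOddPartBound_holds : TwoCopyOddPartBound :=
  twoCopyOddPartBound_of_pushforward twoCopyPushforward_holds

/-- The sourceless loop-O(1) partition function is the sum over even subgraphs. -/
theorem loopO1PartitionFunction_empty_eq {V : Type*} [Fintype V] [DecidableEq V] (G : SimpleGraph V)
    [DecidableRel G.Adj] (t : ℝ) :
    loopO1PartitionFunction G t ∅ = ∑ F ∈ evenSubgraphs G Set.univ, t ^ #F := by
  unfold loopO1PartitionFunction loopO1Weight evenSubgraphs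
  rw [← Finset.sum_filter]
  congr 1
  rw [Finset.filter_mem_eq_inter, Finset.inter_eq_right]
  intro F hF
  exact Finset.mem_powerset.2 ((mem_tJoins G).1 hF).1

/-- **Step (A) COMPLETE — `StrandsJoinBoundShape` (= support item 14647 `StrandsJoinBound`) PROVED**
from 1b by casting to `ℝ` and dividing by `Z[∅]² = cosh(β)^{2|E|}·(Z⁰_{tanh β})²`. -/
theorem strandsJoinBoundShape_holds : StrandsJoinBoundShape := by
  intro V _ _ G _ β hβ a ha
  set K : G.edgeFinset → ℝ := fun _ => β with hKdef
  have hK : ∀ e : G.edgeFinset, 0 ≤ K e := fun _ => hβ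
  set z : Finset V → ℝ := fun A => wcurrentSum K A with hz
  set D : Finset V := {a 0} ∆ ({a 1} ∆ ({a 2} ∆ {a 3})) with hD
  set cE : ℝ := Real.cosh β ^ #G.edgeFinset with hcE
  set Z0 : ℝ := loopO1PartitionFunction G (Real.tanh β) ∅ with hZ0
  set J : ℝ := jointSum G (Real.tanh β) a with hJ
  have ht : 0 ≤ Real.tanh β := by
    rw [Real.tanh_eq_sinh_div_cosh]
    exact div_nonneg (Real.sinh_nonneg_iff.2 hβ) (Real.cosh_pos β).le
  have hcE0 : 0 < cE := pow_pos (Real.cosh_pos β) _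
  have hZ00 : 0 < Z0 := loopO1PartitionFunction_empty_pos G ht
  have hJ0 : 0 ≤ J := by
    refine Finset.sum_nonneg fun F₁ _ => Finset.sum_nonneg fun F₂ _ => ?_
    split_ifs
    · exact pow_nonneg ht _
    · exact le_rfl
  have hz_nonneg : ∀ A, 0 ≤ z A := fun A => wcurrentSum_nonneg hK A
  have hc2 : Real.cosh β ^ (2 * #G.edgeFinset) = cE ^ 2 := by rw [hcE, ← pow_mul']
  -- `Z[∅] = cosh^{|E|} · Z⁰_t`
  have hz0 : z ∅ = cE * Z0 := by
    have h := Summit.CriticalPhenomena.Ising3DConformalLimit.Theorems.ecurrentSum_empty_eq_ofReal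
      (G := G) hβ
    rw [ecurrentSum_eq_ofReal hK] at h
    have h' := congrArg ENNReal.toReal h
    rwa [ENNReal.toReal_ofReal (hz_nonneg ∅), ENNReal.toReal_ofReal
      (mul_nonneg hcE0.le (Finset.sum_nonneg fun F _ => pow_nonneg ht _)),
      ← loopO1PartitionFunction_empty_eq] at h'
  -- 1b cast to `ℝ`
  have h1b := twoCopyOddPartBound_holds V G β hβ a ha
  have eL : ecurrentSum K D * ecurrentSum K ∅ + 2 * ENNReal.ofReal (Real.cosh β ^ (2 * #G.edgeFinset) * J) =
      ENNReal.ofReal (z D * z ∅ + 2 * (cE ^ 2 * J)) := by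
    have h2J : (0:ℝ) ≤ 2 * (cE ^ 2 * J) := mul_nonneg (by norm_num) (mul_nonneg (sq_nonneg _) hJ0)
    rw [ENNReal.ofReal_add (mul_nonneg (hz_nonneg D) (hz_nonneg ∅)) h2J,
      ENNReal.ofReal_mul (hz_nonneg D), ENNReal.ofReal_mul (by norm_num : (0:ℝ) ≤ 2),
      ENNReal.ofReal_ofNat, ecurrentSum_eq_ofReal hK, ecurrentSum_eq_ofReal hK, hc2]
  have eR : ecurrentSum K ({a 0} ∆ {a 1}) * ecurrentSum K ({a 2} ∆ {a 3}) +
        ecurrentSum K ({a 0} ∆ {a 2}) * ecurrentSum K ({a 1} ∆ {a 3}) +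
        ecurrentSum K ({a 0} ∆ {a 3}) * ecurrentSum K ({a 1} ∆ {a 2}) =
      ENNReal.ofReal (z ({a 0} ∆ {a 1}) * z ({a 2} ∆ {a 3}) + z ({a 0} ∆ {a 2}) * z ({a 1} ∆ {a 3}) +
        z ({a 0} ∆ {a 3}) * z ({a 1} ∆ {a 2})) := by
    have hp : ∀ A B : Finset V, 0 ≤ z A * z B := fun A B => mul_nonneg (hz_nonneg A) (hz_nonneg B)
    rw [ENNReal.ofReal_add (add_nonneg (hp _ _) (hp _ _)) (hp _ _), ENNReal.ofReal_add (hp _ _) (hp _ _),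
      ENNReal.ofReal_mul (hz_nonneg _), ENNReal.ofReal_mul (hz_nonneg _), ENNReal.ofReal_mul (hz_nonneg _)]
    simp only [hz, ecurrentSum_eq_ofReal hK]
  have h1bR : z D * z ∅ + 2 * (cE ^ 2 * J) ≤
      z ({a 0} ∆ {a 1}) * z ({a 2} ∆ {a 3}) + z ({a 0} ∆ {a 2}) * z ({a 1} ∆ {a 3}) +
        z ({a 0} ∆ {a 3}) * z ({a 1} ∆ {a 2}) := by
    have hp : ∀ A B : Finset V, 0 ≤ z A * z B := fun A B => mul_nonneg (hz_nonneg A) (hz_nonneg B)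
    have h := h1b
    rw [eL, eR, ENNReal.ofReal_le_ofReal_iff (add_nonneg (add_nonneg (hp _ _) (hp _ _)) (hp _ _))] at h
    exact h
  -- the correlators as current-sum ratios
  have h4 : nPoint (isingMeasure G Finset.univ β 0 .free) spinAt a = z D / z ∅ := by
    have hmono : spinMonomial a = spinMonomial ![a 0, a 1, a 2, a 3] := by
      congr 1; funext i; fin_cases i <;> rfl
    rw [nPoint_isingMeasure, hmono, isingExpect_spinMonomial_four_eq G β (a 0) (a 1) (a 2) (a 3)]
    rfl
  have h2 : ∀ x y : V, twoPoint (isingMeasure G Finset.univ β 0 .free) spinAt x y = z ({x} ∆ {y}) / z ∅ := by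
    intro x y
    rw [twoPoint_isingMeasure, isingTwoPoint_free_eq_currentSum_div_holds G β x y]
    rfl
  show connectedFour (isingMeasure G Finset.univ β 0 .free) spinAt a * Z0 ^ 2 ≤ -(2 * J)
  unfold connectedFour
  simp only [h4, h2, hz0]
  rw [hz0] at h1bR
  have key : (z D / (cE * Z0) - z ({a 0} ∆ {a 1}) / (cE * Z0) * (z ({a 2} ∆ {a 3}) / (cE * Z0)) -
        z ({a 0} ∆ {a 2}) / (cE * Z0) * (z ({a 1} ∆ {a 3}) / (cE * Z0)) -
        z ({a 0} ∆ {a 3}) / (cE * Z0) * (z ({a 1} ∆ {a 2}) / (cE * Z0))) * Z0 ^ 2 =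
      (z D * (cE * Z0) - (z ({a 0} ∆ {a 1}) * z ({a 2} ∆ {a 3}) + z ({a 0} ∆ {a 2}) * z ({a 1} ∆ {a 3}) +
        z ({a 0} ∆ {a 3}) * z ({a 1} ∆ {a 2}))) / cE ^ 2 := by
    field_simp
    ring
  rw [key, div_le_iff₀ (by positivity)]
  nlinarith [h1bR]

end Card1

/-! ### Card 2 — `closed-cone-limit-twice` -/

/-- Bihomogeneity of the defect: the rescaled inequality at mesh `δ` (weights `ρ⁴` on the four-point
term, `ρ²·ρ²` on the products) is `ρ⁴ ×` the lattice inequality, whatever the sign of `ρ`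
(so the hypothesis `0 < ρ δ` of the crux is decoration, as the refuter observed). [folklore] -/
theorem tetraDefect_rescale (ρ c u : ℝ) (g : Fin 4 → Fin 4 → ℝ)
    (h : u - (g 0 1 * g 2 3 + g 0 2 * g 1 3 + g 0 3 * g 1 2) ≤ -(c * (g 0 1 * g 2 3))) :
    ρ ^ 4 * u - (ρ ^ 2 * g 0 1 * (ρ ^ 2 * g 2 3) + ρ ^ 2 * g 0 2 * (ρ ^ 2 * g 1 3) +
        ρ ^ 2 * g 0 3 * (ρ ^ 2 * g 1 2)) ≤ -(c * (ρ ^ 2 * g 0 1 * (ρ ^ 2 * g 2 3))) := by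
  have h4 : (0 : ℝ) ≤ ρ ^ 4 := by positivity
  have := mul_le_mul_of_nonneg_left h h4
  nlinarith [this]

/-- FIRST LEMMA 2b (PROVED) — **mesh exactness**: at mesh `δ_L = L⁻¹` the lattice approximation of an
INTEGER point `x ∈ ℤ^d ⊂ ℝ^d` is exactly the dilate `L • x` (no rounding error), so the lattice bound at
the dilates `L • x` is literally a statement about `rescaledCorrelator _ ρ n L⁻¹` at the fixed
continuum configuration `x`. -/
theorem latticeApprox_inv_natCast {d : ℕ} (x : Site d) (L : ℕ) (hL : 0 < L) :
    latticeApprox ((L : ℝ)⁻¹) (WithLp.toLp 2 fun k => ((x k : ℤ) : ℝ)) = (L : ℤ) • x := by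
  funext k
  rw [latticeApprox_apply]
  have hLr : (0 : ℝ) < L := by exact_mod_cast hL
  show ⌊((x k : ℤ) : ℝ) / ((L : ℝ)⁻¹)⌋ = ((L : ℤ) • x) k
  rw [div_inv_eq_mul, Pi.smul_apply, smul_eq_mul]
  have : ((x k : ℤ) : ℝ) * (L : ℝ) = (((x k * (L : ℤ) : ℤ)) : ℝ) := by push_cast; ring
  rw [this, Int.floor_intCast, mul_comm]

/-- FIRST LEMMA 2c — **pointwise extraction along the mesh sequence**: a pointwise scaling limit gives,
at every non-coincident INTEGER configuration `x`, convergence of `ρ(L⁻¹)^n · G n (L • x)` to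
`S n x` along `L → ∞` (`TendstoLocallyUniformlyOn.tendsto_at` ∘ `tendsto_inv_atTop_nhdsGT_zero ∘
tendsto_natCast_atTop_atTop`, then 2b). Statement only. -/
def AlongMesh (d : ℕ) : Prop :=
  ∀ (G : LatticeCorrFamily d) (ρ : ℝ → ℝ) (S : CorrFamily d), HasPointwiseScalingLimit G ρ S →
    ∀ (n : ℕ) (x : Fin n → Site d), Function.Injective x →
      Tendsto (fun L : ℕ => ρ ((L : ℝ)⁻¹) ^ n * G n (fun i => (L : ℤ) • x i)) atTop
        (𝓝 (S n (fun i => WithLp.toLp 2 fun k => ((x i k : ℤ) : ℝ))))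

/-- 2c PROVED. -/
theorem alongMesh (d : ℕ) : AlongMesh d := by
  intro G ρ S hlim n x hx
  set y : Fin n → EuclideanSpace ℝ (Fin d) := fun i => WithLp.toLp 2 fun k => ((x i k : ℤ) : ℝ) with hy_def
  have hy : y ∈ NonCoincident d n := by
    intro i j hij
    apply hx
    funext k
    have h := congrArg (fun v : EuclideanSpace ℝ (Fin d) => v k) hij
    simpa [hy_def] using h
  have h1 : Tendsto (fun δ => rescaledCorrelator G ρ n δ y) (𝓝[>] 0) (𝓝 (S n y)) :=
    (hlim n).tendsto_at hy
  have h2 : Tendsto (fun L : ℕ => ((L : ℝ)⁻¹)) atTop (𝓝[>] 0) :=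
    tendsto_inv_atTop_nhdsGT_zero.comp tendsto_natCast_atTop_atTop
  refine (h1.comp h2).congr' ?_
  filter_upwards [eventually_gt_atTop 0] with L hL
  simp only [Function.comp_apply, rescaledCorrelator_apply]
  congr 2
  funext i
  exact latticeApprox_inv_natCast (x i) L hL

/-- (B) TRANSPORT, PROVED (template: `wickDeviation_le_box` of `AizenmanWickBound.lean`): the free
Ising measure of the graph INDUCED on a volume `Λ ⊂ ℤ^d` (the crux's `(zdGraph 3).comap Subtype.val`
on `↥(box 3 N)`) has the same spin moments as the free finite-volume measure `⟨·⟩^∅_{Λ}` of `ℤ^d`,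
whose box limits `criticalCorr_wellDefined_holds` controls. -/
theorem nPoint_boxComap {d : ℕ} (Λ : Finset (Site d)) (β : ℝ) {m : ℕ} (y : Fin m → ↥Λ) :
    nPoint (isingMeasure ((zdGraph d).comap (Subtype.val : ↥Λ → Site d)) univ β 0 .free) spinAt y =
      nPoint (isingMeasure (zdGraph d) Λ β 0 .free) spinAt (fun i => (y i : Site d)) := by
  classical
  set ι : ↥Λ ↪ Site d := Function.Embedding.subtype (· ∈ Λ) with hι
  have hmap : (univ : Finset ↥Λ).map ι = Λ := by
    rw [hι, Finset.univ_eq_attach, Finset.attach_map_val]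
  have hadj : ∀ a ∈ (univ : Finset ↥Λ), ∀ b ∈ (univ : Finset ↥Λ),
      ((zdGraph d).Adj (ι a) (ι b) ↔ ((zdGraph d).comap (Subtype.val : ↥Λ → Site d)).Adj a b) :=
    fun _ _ _ _ => Iff.rfl
  have key := isingExpect_free_map (G := (zdGraph d).comap (Subtype.val : ↥Λ → Site d))
    (G' := zdGraph d) ι (Λ := univ) hadj β 0 (measurable_spinMonomial fun i => (y i : Site d))
  rw [hmap] at key
  change isingExpect _ univ β 0 .free (spinMonomial y) =
    isingExpect (zdGraph d) Λ β 0 .free (spinMonomial fun i => (y i : Site d))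
  rw [key]
  congr 1
  funext σ
  simp only [spinMonomial]
  exact Finset.prod_congr rfl fun i _ => (spinAt_extendAlong ι σ (y i)).symm

theorem twoPoint_boxComap {d : ℕ} (Λ : Finset (Site d)) (β : ℝ) (a b : ↥Λ) :
    twoPoint (isingMeasure ((zdGraph d).comap (Subtype.val : ↥Λ → Site d)) univ β 0 .free) spinAt a b =
      twoPoint (isingMeasure (zdGraph d) Λ β 0 .free) spinAt (a : Site d) b := by
  classical
  set ι : ↥Λ ↪ Site d := Function.Embedding.subtype (· ∈ Λ) with hι
  have hmap : (univ : Finset ↥Λ).map ι = Λ := by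
    rw [hι, Finset.univ_eq_attach, Finset.attach_map_val]
  have hadj : ∀ a ∈ (univ : Finset ↥Λ), ∀ b ∈ (univ : Finset ↥Λ),
      ((zdGraph d).Adj (ι a) (ι b) ↔ ((zdGraph d).comap (Subtype.val : ↥Λ → Site d)).Adj a b) :=
    fun _ _ _ _ => Iff.rfl
  have key := isingTwoPoint_free_map (G := (zdGraph d).comap (Subtype.val : ↥Λ → Site d))
    (G' := zdGraph d) ι (Λ := univ) hadj β 0 a b
  rw [hmap] at key
  rw [twoPoint_isingMeasure, twoPoint_isingMeasure]
  exact key.symm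

/-- (B) TRANSPORT of the whole `U₄` combination (PROVED). -/
theorem connectedFour_boxComap {d : ℕ} (Λ : Finset (Site d)) (β : ℝ) (a : Fin 4 → ↥Λ) :
    connectedFour (isingMeasure ((zdGraph d).comap (Subtype.val : ↥Λ → Site d)) univ β 0 .free) spinAt a =
      connectedFour (isingMeasure (zdGraph d) Λ β 0 .free) spinAt (fun i => (a i : Site d)) := by
  simp only [connectedFour, nPoint_boxComap, twoPoint_boxComap]

/-- 2a with only the six PAIR limits (the diagonal entries `g n i i` are unconstrained). -/
theorem tetraDefect_le_of_tendsto' {ι : Type*} {l : Filter ι} [l.NeBot] {c u₀ : ℝ} {u : ι → ℝ}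
    {g : ι → Fin 4 → Fin 4 → ℝ} {g₀ : Fin 4 → Fin 4 → ℝ}
    (hu : Tendsto u l (𝓝 u₀))
    (h01 : Tendsto (fun n => g n 0 1) l (𝓝 (g₀ 0 1))) (h23 : Tendsto (fun n => g n 2 3) l (𝓝 (g₀ 2 3)))
    (h02 : Tendsto (fun n => g n 0 2) l (𝓝 (g₀ 0 2))) (h13 : Tendsto (fun n => g n 1 3) l (𝓝 (g₀ 1 3)))
    (h03 : Tendsto (fun n => g n 0 3) l (𝓝 (g₀ 0 3))) (h12 : Tendsto (fun n => g n 1 2) l (𝓝 (g₀ 1 2)))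
    (h : ∀ᶠ n in l, u n - (g n 0 1 * g n 2 3 + g n 0 2 * g n 1 3 + g n 0 3 * g n 1 2) ≤
      -(c * (g n 0 1 * g n 2 3))) :
    u₀ - (g₀ 0 1 * g₀ 2 3 + g₀ 0 2 * g₀ 1 3 + g₀ 0 3 * g₀ 1 2) ≤ -(c * (g₀ 0 1 * g₀ 2 3)) :=
  le_of_tendsto_of_tendsto
    (hu.sub (((h01.mul h23).add (h02.mul h13)).add (h03.mul h12)))
    ((h01.mul h23).const_mul c).neg h

/-- A pair with distinct entries is an injective configuration. [folklore] -/
theorem injective_vec2 {α : Type*} {p q : α} (h : p ≠ q) : Function.Injective ![p, q] := by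
  intro m n hmn
  fin_cases m <;> fin_cases n
  · rfl
  · exact absurd hmn h
  · exact absurd hmn.symm h
  · rfl

/-- Verbatim restatement of the route's support decl `FarMergingGivesU4` (item 4471). -/
def FarMergingShape : Prop :=
  (∃ c : ℝ, 0 < c ∧ ∃ x : Fin 4 → Site 3, Function.Injective x ∧ ∀ L₀ : ℕ, ∃ L : ℕ, L₀ ≤ L ∧ criticalCorr 3 4 (fun i => (L : ℤ) • x i) - (criticalCorr 3 2 ![(L : ℤ) • x 0, (L : ℤ) • x 1] * criticalCorr 3 2 ![(L : ℤ) • x 2, (L : ℤ) • x 3] + criticalCorr 3 2 ![(L : ℤ) • x 0, (L : ℤ) • x 2] * criticalCorr 3 2 ![(L : ℤ) • x 1, (L : ℤ) • x 3] + criticalCorr 3 2 ![(L : ℤ) • x 0, (L : ℤ) • x 3] * criticalCorr 3 2 ![(L : ℤ) • x 1, (L : ℤ) • x 2]) ≤ -(c * (criticalCorr 3 2 ![(L : ℤ) • x 0, (L : ℤ) • x 1] * criticalCorr 3 2 ![(L : ℤ) • x 2, (L : ℤ) • x 3]))) → ∀ (ρ : ℝ → ℝ) (S : CorrFamily 3),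 (∀ δ ∈ Set.Ioc (0:ℝ) 1, 0 < ρ δ) → HasPointwiseScalingLimit (criticalCorr 3) ρ S → IsNondegenerateTwoPoint S → HasNontrivialU4 S

/-- **Step (C) PROVED — `FarMergingShape` (= support item 4471 `FarMergingGivesU4`)**: mesh
`δ_L = L⁻¹` (2b, 2c), the closed cone (2a') on the NeBot filter `atTop ⊓ 𝓟{good L}`
(`Filter.frequently_iff_neBot`), bihomogeneity (`tetraDefect_rescale`), strictness from ND. -/
theorem farMergingShape_holds : FarMergingShape := by
  rintro ⟨c, hc, x, hx, hfreq⟩ ρ S hρ hlim hnd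
  set y : Fin 4 → EuclideanSpace ℝ (Fin 3) := fun i => WithLp.toLp 2 fun k => ((x i k : ℤ) : ℝ)
    with hy_def
  have hy : Function.Injective y := by
    intro i j hij
    apply hx
    funext k
    have h := congrArg (fun v : EuclideanSpace ℝ (Fin 3) => v k) hij
    simpa [hy_def] using h
  -- the set of good scales and the filter it generates
  set T : Set ℕ := {L | criticalCorr 3 4 (fun i => (L : ℤ) • x i) -
      (criticalCorr 3 2 ![(L : ℤ) • x 0, (L : ℤ) • x 1] * criticalCorr 3 2 ![(L : ℤ) • x 2, (L : ℤ) • x 3] +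
        criticalCorr 3 2 ![(L : ℤ) • x 0, (L : ℤ) • x 2] * criticalCorr 3 2 ![(L : ℤ) • x 1, (L : ℤ) • x 3] +
        criticalCorr 3 2 ![(L : ℤ) • x 0, (L : ℤ) • x 3] * criticalCorr 3 2 ![(L : ℤ) • x 1, (L : ℤ) • x 2]) ≤
      -(c * (criticalCorr 3 2 ![(L : ℤ) • x 0, (L : ℤ) • x 1] *
        criticalCorr 3 2 ![(L : ℤ) • x 2, (L : ℤ) • x 3]))} with hT
  have hfreqT : ∃ᶠ L in atTop, L ∈ T :=
    Filter.frequently_atTop.2 fun L₀ => (hfreq L₀).imp fun L hL => ⟨hL.1, hL.2⟩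
  haveI hne : (atTop ⊓ 𝓟 T).NeBot := Filter.frequently_iff_neBot.mp hfreqT
  -- the seven limits along `atTop`
  have hu : Tendsto (fun L : ℕ => ρ ((L : ℝ)⁻¹) ^ 4 * criticalCorr 3 4 (fun i => (L : ℤ) • x i)) atTop
      (𝓝 (S 4 y)) := alongMesh 3 (criticalCorr 3) ρ S hlim 4 x hx
  have hpair : ∀ i j : Fin 4, i ≠ j →
      Tendsto (fun L : ℕ => ρ ((L : ℝ)⁻¹) ^ 2 * criticalCorr 3 2 ![(L : ℤ) • x i, (L : ℤ) • x j]) atTop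
        (𝓝 (S 2 ![y i, y j])) := by
    intro i j hij
    have hxij : Function.Injective ![x i, x j] := injective_vec2 (hx.ne hij)
    have h := alongMesh 3 (criticalCorr 3) ρ S hlim 2 ![x i, x j] hxij
    have e2 : (fun m : Fin 2 => WithLp.toLp 2 fun k => (((![x i, x j] : Fin 2 → Site 3) m k : ℤ) : ℝ)) =
        ![y i, y j] := by
      funext m
      fin_cases m <;> rfl
    rw [e2] at h
    refine h.congr' (Eventually.of_forall fun L => ?_)
    show ρ ((L : ℝ)⁻¹) ^ 2 * criticalCorr 3 2 (fun m => (L : ℤ) • (![x i, x j] : Fin 2 → Site 3) m) =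
      ρ ((L : ℝ)⁻¹) ^ 2 * criticalCorr 3 2 ![(L : ℤ) • x i, (L : ℤ) • x j]
    congr 2
    funext m
    fin_cases m <;> rfl
  -- the closed cone along the NeBot filter
  have key := tetraDefect_le_of_tendsto' (l := atTop ⊓ 𝓟 T) (c := c) (u₀ := S 4 y)
    (g₀ := fun i j => S 2 ![y i, y j])
    (g := fun (L : ℕ) (i j : Fin 4) => ρ ((L : ℝ)⁻¹) ^ 2 * criticalCorr 3 2 ![(L : ℤ) • x i, (L : ℤ) • x j])
    (hu.mono_left inf_le_left)
    ((hpair 0 1 (by decide)).mono_left inf_le_left) ((hpair 2 3 (by decide)).mono_left inf_le_left)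
    ((hpair 0 2 (by decide)).mono_left inf_le_left) ((hpair 1 3 (by decide)).mono_left inf_le_left)
    ((hpair 0 3 (by decide)).mono_left inf_le_left) ((hpair 1 2 (by decide)).mono_left inf_le_left)
    (Filter.eventually_inf_principal.2 (Eventually.of_forall fun L hL =>
      tetraDefect_rescale (ρ ((L : ℝ)⁻¹)) c (criticalCorr 3 4 (fun i => (L : ℤ) • x i))
        (fun i j => criticalCorr 3 2 ![(L : ℤ) • x i, (L : ℤ) • x j]) hL))
  -- strictness from non-degeneracy
  have h01y : Function.Injective ![y 0, y 1] := injective_vec2 (hy.ne (by decide))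
  have h23y : Function.Injective ![y 2, y 3] := injective_vec2 (hy.ne (by decide))
  have hpos : 0 < c * (S 2 ![y 0, y 1] * S 2 ![y 2, y 3]) :=
    mul_pos hc (mul_pos (hnd _ h01y) (hnd _ h23y))
  refine ⟨y, hy, ?_⟩
  show S 4 y - (S 2 ![y 0, y 1] * S 2 ![y 2, y 3] + S 2 ![y 0, y 2] * S 2 ![y 1, y 3] +
      S 2 ![y 0, y 3] * S 2 ![y 1, y 2]) ≠ 0
  beta_reduce at key
  exact ne_of_lt (lt_of_le_of_lt key (by linarith))

/-- The tetrahedral shape of the route. -/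
def tetra : Fin 4 → Site 3 := ![![-1, -1, -1], ![1, 1, -1], ![1, -1, 1], ![-1, 1, 1]]

theorem tetra_injective : Function.Injective tetra := by
  unfold tetra; decide

/-! ### Step (B) — `LatticeBoundFromStrands` (support item 14648) -/

section StepB

open scoped Classical

/-- `Z_β[A] = cosh(β)^{|E|} · Z^A_{tanh β}` for every source set `A` (the one-copy pushforward with
`g ≡ 1`; generalises the landed `ecurrentSum_empty_eq_ofReal`). -/
theorem ecurrentSum_eq_ofReal_loopO1 {V : Type*} [Fintype V] [DecidableEq V] {G : SimpleGraph V}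
    [DecidableRel G.Adj] {β : ℝ} (hβ : 0 ≤ β) (A : Finset V) :
    ecurrentSum (fun _ : G.edgeFinset => β) A =
      ENNReal.ofReal (Real.cosh β ^ #G.edgeFinset * loopO1PartitionFunction G (Real.tanh β) A) := by
  have ht : 0 ≤ Real.tanh β := by
    rw [Real.tanh_eq_sinh_div_cosh]
    exact div_nonneg (Real.sinh_nonneg_iff.2 hβ) (Real.cosh_pos β).le
  have h := Summit.CriticalPhenomena.Ising3DConformalLimit.Theorems.tsum_sources_eweight_mul_apply_oddPart
    (G := G) hβ A (fun _ => 1)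
  simp only [mul_one] at h
  unfold ecurrentSum
  rw [h]
  unfold loopO1PartitionFunction loopO1Weight
  rw [Finset.mul_sum, ENNReal.ofReal_sum_of_nonneg (fun F _ => by
    split_ifs
    · exact mul_nonneg (pow_nonneg (Real.cosh_pos β).le _) (pow_nonneg ht _)
    · rw [mul_zero])]
  refine Finset.sum_congr rfl fun F hF => ?_
  have hle : #F ≤ #G.edgeFinset := Finset.card_le_card (Finset.mem_powerset.1 hF)
  by_cases hc : (∀ v, Odd #(F.filter (v ∈ ·)) ↔ v ∈ A)
  · have hc' : F ∈ tJoins G Set.univ A :=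
      (mem_tJoins G).2 ⟨Finset.mem_powerset.1 hF, Set.subset_univ _, hc⟩
    rw [if_pos hc, if_pos hc',
      Summit.CriticalPhenomena.Ising3DConformalLimit.Theorems.sinh_pow_mul_cosh_pow_sub β hle]
  · have hc' : F ∉ tJoins G Set.univ A := fun h => hc ((mem_tJoins G).1 h).2.2
    rw [if_neg hc, if_neg hc', mul_zero, ENNReal.ofReal_zero]

/-- Free two-point function of a finite graph as a ratio of loop-O(1) partition functions:
`⟨σ_xσ_y⟩ = Z^{xy}_t / Z^∅_t`, `t = tanh β`, `x ≠ y`. -/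
theorem twoPoint_eq_loopO1_div {V : Type*} [Fintype V] [DecidableEq V] {G : SimpleGraph V}
    [DecidableRel G.Adj] {β : ℝ} (hβ : 0 ≤ β) {x y : V} (hxy : x ≠ y) :
    twoPoint (isingMeasure G Finset.univ β 0 .free) spinAt x y =
      loopO1PartitionFunction G (Real.tanh β) {x, y} / loopO1PartitionFunction G (Real.tanh β) ∅ := by
  have ht : 0 ≤ Real.tanh β := by
    rw [Real.tanh_eq_sinh_div_cosh]
    exact div_nonneg (Real.sinh_nonneg_iff.2 hβ) (Real.cosh_pos β).le
  have hK : ∀ _e : G.edgeFinset, 0 ≤ β := fun _ => hβ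
  have hcE : 0 < Real.cosh β ^ #G.edgeFinset := pow_pos (Real.cosh_pos β) _
  have hz : ∀ A : Finset V, wcurrentSum (fun _ : G.edgeFinset => β) A =
      Real.cosh β ^ #G.edgeFinset * loopO1PartitionFunction G (Real.tanh β) A := by
    intro A
    rw [← toReal_ecurrentSum hK, ecurrentSum_eq_ofReal_loopO1 hβ A, ENNReal.toReal_ofReal
      (mul_nonneg hcE.le (loopO1PartitionFunction_nonneg G ht A))]
  rw [twoPoint_isingMeasure, isingTwoPoint_free_eq_currentSum_div_holds G β x y,
    Current.symmDiff_singleton_eq_pair hxy, currentSum_eq_wcurrentSum, currentSum_eq_wcurrentSum, hz, hz,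
    mul_div_mul_left _ _ hcE.ne']

/-- The two-point monomial is the two-point function. [folklore] -/
theorem isingExpect_spinMonomial_two {V : Type*} [DecidableEq V] (G : SimpleGraph V) [DecidableRel G.Adj]
    [G.LocallyFinite] (Λ : Finset V) (β : ℝ) (x y : V) :
    isingExpect G Λ β 0 .free (spinMonomial ![x, y]) = twoPoint (isingMeasure G Λ β 0 .free) spinAt x y := by
  rw [← nPoint_isingMeasure]
  simp only [nPoint, twoPoint, Fin.prod_univ_two, Matrix.cons_val_zero, Matrix.cons_val_one]

/-- Verbatim restatement of the route's support decl `LatticeBoundFromStrands` (item 14648), with the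
inlined `StrandsJoinBound` written as `StrandsJoinBoundShape`. -/
def LatticeBoundShape : Prop :=
  IndependentStrandsJoin → StrandsJoinBoundShape →
    let tetra : Fin 4 → Site 3 := ![![-1, -1, -1], ![1, 1, -1], ![1, -1, 1], ![-1, 1, 1]];
    ∃ c : ℝ, 0 < c ∧ ∀ l : ℕ, 1 ≤ l →
      criticalCorr 3 4 (fun i => (l : ℤ) • tetra i) -
          (criticalCorr 3 2 ![(l : ℤ) • tetra 0, (l : ℤ) • tetra 1] * criticalCorr 3 2 ![(l : ℤ) • tetra 2, (l : ℤ) • tetra 3] +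
            criticalCorr 3 2 ![(l : ℤ) • tetra 0, (l : ℤ) • tetra 2] * criticalCorr 3 2 ![(l : ℤ) • tetra 1, (l : ℤ) • tetra 3] +
            criticalCorr 3 2 ![(l : ℤ) • tetra 0, (l : ℤ) • tetra 3] * criticalCorr 3 2 ![(l : ℤ) • tetra 1, (l : ℤ) • tetra 2]) ≤
        -(c * (criticalCorr 3 2 ![(l : ℤ) • tetra 0, (l : ℤ) • tetra 1] * criticalCorr 3 2 ![(l : ℤ) • tetra 2, (l : ℤ) • tetra 3]))

/-- The dilated tetrahedron sits in every box of radius `≥ l`. -/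
theorem smul_tetra_mem_box {l N : ℕ} (h : l ≤ N) (i : Fin 4) : (l : ℤ) • tetra i ∈ box 3 N := by
  rw [mem_box]
  intro k
  have hl : ((l : ℕ) : ℤ) ≤ N := by exact_mod_cast h
  fin_cases i <;> fin_cases k <;> simp [tetra] <;> omega

/-- The algebra of step (B) on a general finite graph: a joint-strand lower bound `c·Z·Z ≤ J` and the
(A)-inequality `U₄·(Z⁰)² ≤ -2J` give the defect inequality `U₄ ≤ -2c·⟨σσ⟩⟨σσ⟩`. -/
theorem defect_of_join {V : Type*} [Fintype V] [DecidableEq V] (G : SimpleGraph V) [DecidableRel G.Adj]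
    {β c J : ℝ} (hβ : 0 ≤ β) (a : Fin 4 → V) (ha : Function.Injective a)
    (hJ : c * loopO1PartitionFunction G (Real.tanh β) {a 0, a 1} *
      loopO1PartitionFunction G (Real.tanh β) {a 2, a 3} ≤ J)
    (hS : connectedFour (isingMeasure G Finset.univ β 0 .free) spinAt a *
      (loopO1PartitionFunction G (Real.tanh β) ∅) ^ 2 ≤ -(2 * J)) :
    connectedFour (isingMeasure G Finset.univ β 0 .free) spinAt a ≤
      -(2 * c * (twoPoint (isingMeasure G Finset.univ β 0 .free) spinAt (a 0) (a 1) *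
        twoPoint (isingMeasure G Finset.univ β 0 .free) spinAt (a 2) (a 3))) := by
  have ht : 0 ≤ Real.tanh β := by
    rw [Real.tanh_eq_sinh_div_cosh]
    exact div_nonneg (Real.sinh_nonneg_iff.2 hβ) (Real.cosh_pos β).le
  have hZ0 : 0 < loopO1PartitionFunction G (Real.tanh β) ∅ := loopO1PartitionFunction_empty_pos G ht
  have h2 : connectedFour (isingMeasure G Finset.univ β 0 .free) spinAt a *
      (loopO1PartitionFunction G (Real.tanh β) ∅) ^ 2 ≤
      -(2 * c * (loopO1PartitionFunction G (Real.tanh β) {a 0, a 1} *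
        loopO1PartitionFunction G (Real.tanh β) {a 2, a 3})) := by linarith
  rw [twoPoint_eq_loopO1_div hβ (ha.ne (by decide)), twoPoint_eq_loopO1_div hβ (ha.ne (by decide)),
    div_mul_div_comm, ← sq,
    show -(2 * c * (loopO1PartitionFunction G (Real.tanh β) {a 0, a 1} *
        loopO1PartitionFunction G (Real.tanh β) {a 2, a 3} / loopO1PartitionFunction G (Real.tanh β) ∅ ^ 2)) =
      -(2 * c * (loopO1PartitionFunction G (Real.tanh β) {a 0, a 1} *
        loopO1PartitionFunction G (Real.tanh β) {a 2, a 3})) / loopO1PartitionFunction G (Real.tanh β) ∅ ^ 2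
      by ring,
    le_div_iff₀ (pow_pos hZ0 2)]
  exact h2

/-- **Step (B) PROVED — `LatticeBoundShape`**: K1 at `N ≥ max N₀ l` + (A) on the induced box graph give
the finite-volume defect inequality; transport (`connectedFour_boxComap`) and the seven free box limits
(`criticalCorr_wellDefined_holds`) close it by the closed cone (2a'). -/
theorem latticeBoundShape_holds : LatticeBoundShape := by
  intro hK1 hSJB
  obtain ⟨c, hc, hK⟩ := hK1
  refine ⟨2 * c, by positivity, fun l hl => ?_⟩
  obtain ⟨N₀, hN⟩ := hK l hl
  have hl0 : ((l : ℕ) : ℤ) ≠ 0 := by exact_mod_cast (Nat.one_le_iff_ne_zero.1 hl)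
  have hp : Function.Injective (fun i : Fin 4 => (l : ℤ) • tetra i) := fun i j h =>
    tetra_injective (smul_right_injective (Site 3) hl0 h)
  have hβ : 0 ≤ criticalBeta 3 := criticalBeta_nonneg 3
  -- the finite-volume inequality for `N ≥ max N₀ l`
  have hfin : ∀ N : ℕ, max N₀ l ≤ N →
      isingExpect (zdGraph 3) (box 3 N) (criticalBeta 3) 0 .free (spinMonomial fun i : Fin 4 => (l : ℤ) • tetra i) -
          (isingExpect (zdGraph 3) (box 3 N) (criticalBeta 3) 0 .free (spinMonomial ![(l : ℤ) • tetra 0, (l : ℤ) • tetra 1]) *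
              isingExpect (zdGraph 3) (box 3 N) (criticalBeta 3) 0 .free (spinMonomial ![(l : ℤ) • tetra 2, (l : ℤ) • tetra 3]) +
            isingExpect (zdGraph 3) (box 3 N) (criticalBeta 3) 0 .free (spinMonomial ![(l : ℤ) • tetra 0, (l : ℤ) • tetra 2]) *
              isingExpect (zdGraph 3) (box 3 N) (criticalBeta 3) 0 .free (spinMonomial ![(l : ℤ) • tetra 1, (l : ℤ) • tetra 3]) +
            isingExpect (zdGraph 3) (box 3 N) (criticalBeta 3) 0 .free (spinMonomial ![(l : ℤ) • tetra 0, (l : ℤ) • tetra 3]) *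
              isingExpect (zdGraph 3) (box 3 N) (criticalBeta 3) 0 .free (spinMonomial ![(l : ℤ) • tetra 1, (l : ℤ) • tetra 2])) ≤
        -(2 * c * (isingExpect (zdGraph 3) (box 3 N) (criticalBeta 3) 0 .free (spinMonomial ![(l : ℤ) • tetra 0, (l : ℤ) • tetra 1]) *
          isingExpect (zdGraph 3) (box 3 N) (criticalBeta 3) 0 .free (spinMonomial ![(l : ℤ) • tetra 2, (l : ℤ) • tetra 3]))) := by
    intro N hNl
    have hN₀N : N₀ ≤ N := le_of_max_le_left hNl
    have hlN : l ≤ N := le_of_max_le_right hNl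
    -- K1's configuration inside the box
    let a : Fin 4 → ↥(box 3 N) := fun i => ⟨(l : ℤ) • tetra i, smul_tetra_mem_box hlN i⟩
    have ha : ∀ i, ((a i : Site 3)) = (l : ℤ) • tetra i := fun i => rfl
    have hainj : Function.Injective a := fun i j h => hp (congrArg Subtype.val h)
    -- K1 at `N` and (A) on the induced graph, combined on the induced graph
    have hU := defect_of_join ((zdGraph 3).comap (Subtype.val : ↥(box 3 N) → Site 3)) hβ a hainj
      (hN N hN₀N a ha) (hSJB _ ((zdGraph 3).comap (Subtype.val : ↥(box 3 N) → Site 3)) (criticalBeta 3) hβ a hainj)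
    -- transport to the free box measure of `ℤ³`
    rw [connectedFour_boxComap (box 3 N) (criticalBeta 3) a, twoPoint_boxComap (box 3 N) (criticalBeta 3) (a 0) (a 1),
      twoPoint_boxComap (box 3 N) (criticalBeta 3) (a 2) (a 3)] at hU
    unfold connectedFour at hU
    rw [nPoint_isingMeasure] at hU
    simp only [← isingExpect_spinMonomial_two] at hU
    -- `(a i : Site 3) = l • tetra i` definitionally
    have hU' : isingExpect (zdGraph 3) (box 3 N) (criticalBeta 3) 0 .free (spinMonomial fun i : Fin 4 => (l : ℤ) • tetra i) -
          isingExpect (zdGraph 3) (box 3 N) (criticalBeta 3) 0 .free (spinMonomial ![(l : ℤ) • tetra 0, (l : ℤ) • tetra 1]) *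
            isingExpect (zdGraph 3) (box 3 N) (criticalBeta 3) 0 .free (spinMonomial ![(l : ℤ) • tetra 2, (l : ℤ) • tetra 3]) -
          isingExpect (zdGraph 3) (box 3 N) (criticalBeta 3) 0 .free (spinMonomial ![(l : ℤ) • tetra 0, (l : ℤ) • tetra 2]) *
            isingExpect (zdGraph 3) (box 3 N) (criticalBeta 3) 0 .free (spinMonomial ![(l : ℤ) • tetra 1, (l : ℤ) • tetra 3]) -
          isingExpect (zdGraph 3) (box 3 N) (criticalBeta 3) 0 .free (spinMonomial ![(l : ℤ) • tetra 0, (l : ℤ) • tetra 3]) *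
            isingExpect (zdGraph 3) (box 3 N) (criticalBeta 3) 0 .free (spinMonomial ![(l : ℤ) • tetra 1, (l : ℤ) • tetra 2]) ≤
        -(2 * c * (isingExpect (zdGraph 3) (box 3 N) (criticalBeta 3) 0 .free (spinMonomial ![(l : ℤ) • tetra 0, (l : ℤ) • tetra 1]) *
          isingExpect (zdGraph 3) (box 3 N) (criticalBeta 3) 0 .free (spinMonomial ![(l : ℤ) • tetra 2, (l : ℤ) • tetra 3]))) := hU
    linarith
  -- the seven free box limits and the closed cone
  have hwd := criticalCorr_wellDefined_holds (d := 3) le_rfl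
  have hfree : (BoundaryCondition.free : BoundaryCondition (Site 3)) ∈
      ({.free, .plus, .minus} : Set (BoundaryCondition (Site 3))) := by simp
  have key := tetraDefect_le_of_tendsto' (l := atTop) (c := 2 * c)
    (u₀ := criticalCorr 3 4 (fun i : Fin 4 => (l : ℤ) • tetra i))
    (g₀ := fun i j => criticalCorr 3 2 ![(l : ℤ) • tetra i, (l : ℤ) • tetra j])
    (g := fun (N : ℕ) (i j : Fin 4) =>
      isingExpect (zdGraph 3) (box 3 N) (criticalBeta 3) 0 .free (spinMonomial ![(l : ℤ) • tetra i, (l : ℤ) • tetra j]))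
    (hwd 4 (fun i : Fin 4 => (l : ℤ) • tetra i) .free hfree)
    (hwd 2 ![(l : ℤ) • tetra 0, (l : ℤ) • tetra 1] .free hfree) (hwd 2 ![(l : ℤ) • tetra 2, (l : ℤ) • tetra 3] .free hfree)
    (hwd 2 ![(l : ℤ) • tetra 0, (l : ℤ) • tetra 2] .free hfree) (hwd 2 ![(l : ℤ) • tetra 1, (l : ℤ) • tetra 3] .free hfree)
    (hwd 2 ![(l : ℤ) • tetra 0, (l : ℤ) • tetra 3] .free hfree) (hwd 2 ![(l : ℤ) • tetra 1, (l : ℤ) • tetra 2] .free hfree)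
    (Filter.eventually_atTop.2 ⟨max N₀ l, fun N hN => hfin N hN⟩)
  exact key

end StepB

/-! ### THE CRUX — `JoinForcesU4` (item 14627) PROVED: (A) ∘ (B) ∘ (C) -/

/-- **`JoinForcesU4` holds** (the route's rank-6 bridge crux, item `stmt-CriticalPhenomena-14627`):
`IndependentStrandsJoin → NonGaussianLimit`, by `latticeBoundShape_holds` (step (B), fed with the crux
hypothesis and step (A) `strandsJoinBoundShape_holds`) and `farMergingShape_holds` (step (C)) at the
shape `tetra` along the scales `max L₀ 1`. Axioms: propext, Classical.choice, Quot.sound. -/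
theorem joinForcesU4_holds : JoinForcesU4 := by
  intro hK1 ρ S hρ hlim hnd
  obtain ⟨c, hc, hlat⟩ := latticeBoundShape_holds hK1 strandsJoinBoundShape_holds
  exact farMergingShape_holds ⟨c, hc, tetra, tetra_injective, fun L₀ =>
    ⟨max L₀ 1, le_max_left _ _, hlat (max L₀ 1) (le_max_right _ _)⟩⟩ ρ S hρ hlim hnd

/-! ### The three supports of the chain, against the route's own decls -/

/-- Support item 14647 `StrandsJoinBound` holds. -/
theorem strandsJoinBound_holds : StrandsJoinBound := strandsJoinBoundShape_holds

/-- Support item 4471 `FarMergingGivesU4` holds. -/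
theorem farMergingGivesU4_holds : FarMergingGivesU4 := farMergingShape_holds

/-- Support item 14648 `LatticeBoundFromStrands` holds. -/
theorem latticeBoundFromStrands_holds : LatticeBoundFromStrands :=
  fun h1 h2 => latticeBoundShape_holds h1 h2


end

end Summit.CriticalPhenomena.Ising3DConformalLimit.Theorems.JoinForcesU4Proof
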